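import Summits.RiemannHypothesis.RiemannHypothesis.Theorems.GroundBartaPolarPerronFrobeniusGapCert83
import Summits.RiemannHypothesis.RiemannHypothesis.Theorems.GroundBartaPolarPerronFrobeniusGapTransferWindowsTw2
import Summits.RiemannHypothesis.RiemannHypothesis.Theorems.GroundBartaEvenWinsBeyondArchDeflationN83OLast
import Summits.RiemannHypothesis.RiemannHypothesis.Theorems.WeilParityEvenWinsBeyondArchCell83CompleteOfOddLower
import HarnessLib

/-!
# Every ground state of the windowed Weil form at `a = 83/100` is non-negative up to `1/74000` in `L²` (unconditional)
(route `RiemannHypothesis/GroundBarta`, crux `PolarPerronFrobenius` = stmt-RiemannHypothesis-18390, helper; RH-free, no definitions,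
no named facts, no sorry)

Consequences of the even gap certificate at `83/100` (`gc_gapCertificate_83`, `…GapCert83`), the window lemmas of
`…GapTransferWindows` (cone bottom + W-M4 positivity at `83/100`), and — for the FULL form — the parity order of the landed parity
cell 7 (`n83O_oddLower_lit : 2·10⁻¹⁷ ≤ ε_od(83/100)`, `…N83OLast`, via `groundStates_ae_even_of_le_83_of_oddLower`):
* `even_groundState_83_almost_nonneg`, `even_groundState_83_negPart_le` — every even-sector ground state at `83/100` is real and
  `≥ 0` up to `1/74000` in `L²`;
* `groundState_83_negPart_le_of_ae_even` — the same for the full form given the parity of its ground states;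
* ★ `groundState_83_negPart_le` — **unconditionally: every ground state `u` of the full windowed Weil form at `a = 83/100` has a
  unit scalar `c` with `∫ ((Re(c u))⁻)² + (Im(c u))² ≤ 1/74000`** — Perron–Frobenius up to `0.4 %` at the frontier window of the
  parity ladder;
* ★ BAND VERSION `groundState_band83_almost_nonneg` / `groundState_band83_negPart_le` — **for EVERY window
  `a ∈ [4023/5000, 83/100]` (across the prime threshold `(log 5)/2`) and every ground state `u` at `a`:
  `∫ ((Re(c u))⁻)² + (Im(c u))² ≤ 1/3700` for a unit `c`**: the `83/100` certificate restricted to the window `a` (`Q` does not see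
  the window), the cone bottom `ε₊(a) ≤ ε₊(4023/5000) ≤ 10⁻¹⁷` (`coneBottom_le_of_ge_8046`), W-M4 positivity, and the parity
  order on `(0, 83/100]`.  With `…GapCert8046Sign` (`[39/50, 4023/5000]`, `1/4400`): every ground state of the windowed Weil form
  is non-negative up to `1/3700` in `L²` uniformly on the band `[39/50, 83/100]`.  Prover B, speedrun unit `sr-gb-rung-b` (gen 17).
-/

set_option linter.dupNamespace false
set_option linter.unusedSimpArgs false

noncomputable section

open MeasureTheory Set Filter
open scoped Topology ENNReal NNReal ComplexConjugate BigOperators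

namespace Summit.RiemannHypothesis.RiemannHypothesis.Theorems.PolarPerronFrobenius

open Literature.NumberTheory.LFunctions Literature.NumberTheory.LFunctions.ConnesVanSuijlekom
open Literature.Analysis.ValidatedNumerics.PolyMP
open Summit.RiemannHypothesis.RiemannHypothesis.Theorems.EvenWinsBeyondArch
open Summit.RiemannHypothesis.RiemannHypothesis.Theorems.OddSector (weilDirichletEnergy₂ weilPoleForm₂)

/-- **Every EVEN-SECTOR ground state at `a = 83/100` is almost non-negative (unconditional).**  For every `δ' > 483·10⁻²¹` with
`2δ' < 1.5·10⁻¹³` and every even-sector ground state `u` at `83/100`, some unit `c` has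
`∫ ((Re(c u))⁻)² + (Im(c u))² ≤ 4δ'/(1.5·10⁻¹³ − 2δ')`. [folklore] -/
theorem even_groundState_83_almost_nonneg {δ' : ℝ} (hδ' : (483 / 1000000000000000000000 : ℝ) < δ')
    (hm : 2 * δ' < (3 / 20000000000000 : ℝ)) {u : ℝ → ℂ} (hu : IsWeilEvenGroundState (83 / 100 : ℝ) u) :
    ∃ c : ℂ, ‖c‖ = 1 ∧
      ∫ t, (max (-(c * u t).re) 0) ^ 2 + ((c * u t).im) ^ 2 ≤ 4 * δ' / (3 / 20000000000000 - 2 * δ') :=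
  even_groundState_83_almost_nonneg_of_gapCertificate_tw2 gc_memLp_m83Ev0 hδ' hm gc_gapCertificate_83 hu

/-- **Every even-sector ground state at `a = 83/100` is non-negative up to `0.4 %` in `L²`**: `∫ ((Re(c u))⁻)² + (Im(c u))² ≤ 1/74000`
for a unit `c` (`δ' = 5·10⁻¹⁹`). [folklore] -/
theorem even_groundState_83_negPart_le {u : ℝ → ℂ} (hu : IsWeilEvenGroundState (83 / 100 : ℝ) u) :
    ∃ c : ℂ, ‖c‖ = 1 ∧ ∫ t, (max (-(c * u t).re) 0) ^ 2 + ((c * u t).im) ^ 2 ≤ 1 / 74000 := by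
  obtain ⟨c, hc, h⟩ := even_groundState_83_almost_nonneg (δ' := 5 / 10000000000000000000) (by norm_num) (by norm_num) hu
  exact ⟨c, hc, h.trans (by norm_num)⟩

/-- **Full-form version at `83/100`, modulo the parity order** (ground states a.e. even at `83/100`, which the cell's odd block
`ε_od(83/100) > ε_ev(83/100)` gives): every ground state of the full windowed form then satisfies the same bound. [folklore] -/
theorem groundState_83_negPart_le_of_ae_even
    (hpar : ∀ u : ℝ → ℂ, IsWeilGroundState (83 / 100 : ℝ) u → u =ᵐ[volume] fun t ↦ u (-t))
    {u : ℝ → ℂ} (hu : IsWeilGroundState (83 / 100 : ℝ) u) :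
    ∃ c : ℂ, ‖c‖ = 1 ∧ ∫ t, (max (-(c * u t).re) 0) ^ 2 + ((c * u t).im) ^ 2 ≤ 1 / 74000 := by
  obtain ⟨hsym, hue⟩ := isWeilEvenGroundState_symm_of_ae_even_tw2 hu (hpar u hu)
  obtain ⟨c, hc, hint⟩ := even_groundState_83_negPart_le hue
  exact ⟨c, hc, (integral_negPart_sq_add_im_sq_congr_ae_tw2 hsym c) ▸ hint⟩

/-- ★ **EVERY GROUND STATE OF THE WINDOWED WEIL FORM AT `a = 83/100` IS NON-NEGATIVE UP TO `1/74000` IN `L²` (unconditional,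
RH-free).**  The parity hypothesis of `groundState_83_negPart_le_of_ae_even` is discharged by the landed parity cell 7: the odd
block `n83O_oddLower_lit` (`2·10⁻¹⁷ ≤ ε_od(83/100)`) beats the even U-side `10⁻¹⁷`, so every ground state at `83/100` is a.e. even
(`groundStates_ae_even_of_le_83_of_oddLower`). [folklore] -/
theorem groundState_83_negPart_le {u : ℝ → ℂ} (hu : IsWeilGroundState (83 / 100 : ℝ) u) :
    ∃ c : ℂ, ‖c‖ = 1 ∧ ∫ t, (max (-(c * u t).re) 0) ^ 2 + ((c * u t).im) ^ 2 ≤ 1 / 74000 :=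
  groundState_83_negPart_le_of_ae_even
    (fun v hv ↦ groundStates_ae_even_of_le_83_of_oddLower (L := (2 : ℝ) / 10 ^ 17) (by norm_num) n83O_oddLower_lit
      (83 / 100) (by norm_num) le_rfl v hv) hu

/-! ## Band version `[4023/5000, 83/100]` -/

/-- **Band form at the frontier.**  For every window `a ∈ [4023/5000, 83/100]`, every `δ' > 10⁻¹⁷` with `2δ' < 1.5·10⁻¹³` and
every ground state `u` of the full windowed Weil form at `a`, some unit `c` has `∫ ((Re(c u))⁻)² + (Im(c u))² ≤ 4δ'/(1.5·10⁻¹³ − 2δ')`: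
`gc_gapCertificate_83` restricted to the window `a`, cone bottom `coneBottom_le_of_ge_8046`, positivity `weilPositivityOn_83_of_one.mono`,
parity `groundStates_ae_even_of_le_83_of_oddLower` + `n83O_oddLower_lit`. [folklore] -/
theorem groundState_band83_almost_nonneg {a δ' : ℝ} (ha : (4023 / 5000 : ℝ) ≤ a) (ha' : a ≤ 83 / 100)
    (hδ' : (1 / 100000000000000000 : ℝ) < δ') (hm : 2 * δ' < (3 / 20000000000000 : ℝ)) {u : ℝ → ℂ}
    (hu : IsWeilGroundState a u) :
    ∃ c : ℂ, ‖c‖ = 1 ∧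
      ∫ t, (max (-(c * u t).re) 0) ^ 2 + ((c * u t).im) ^ 2 ≤ 4 * δ' / (3 / 20000000000000 - 2 * δ') := by
  have ha0 : 0 < a := lt_of_lt_of_le (by norm_num) ha
  have hae := groundStates_ae_even_of_le_83_of_oddLower (L := (2 : ℝ) / 10 ^ 17) (by norm_num) n83O_oddLower_lit
    a ha0 ha' u hu
  obtain ⟨hsym, hue⟩ := isWeilEvenGroundState_symm_of_ae_even_tw2 hu hae
  have hI : Icc (-a) a ⊆ Icc (-(83 / 100 : ℝ)) (83 / 100) := Icc_subset_Icc (neg_le_neg ha') ha'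
  obtain ⟨c, hc, hint⟩ := even_groundState_almost_nonneg_of_coneBottom_lt_tw2 ha0
    (WeilPositivityOn.mono ha' weilPositivityOn_83_of_one_tw2) ((coneBottom_le_of_ge_8046 ha).trans_lt hδ') hue
    gc_memLp_m83Ev0 hm
    (fun k hk hs he ho ↦ gc_gapCertificate_83 k hk (hs.trans hI) he ho)
  exact ⟨c, hc, (integral_negPart_sq_add_im_sq_congr_ae_tw2 hsym c) ▸ hint⟩

/-- ★ **BAND `[4023/5000, 83/100]`: EVERY GROUND STATE OF THE WINDOWED WEIL FORM AT EVERY `a ∈ [4023/5000, 83/100]` IS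
NON-NEGATIVE UP TO `1/3700` IN `L²` (unconditional, RH-free, uniform on the band; `δ' = 1.01·10⁻¹⁷`).** [folklore] -/
theorem groundState_band83_negPart_le {a : ℝ} (ha : (4023 / 5000 : ℝ) ≤ a) (ha' : a ≤ 83 / 100) {u : ℝ → ℂ}
    (hu : IsWeilGroundState a u) :
    ∃ c : ℂ, ‖c‖ = 1 ∧ ∫ t, (max (-(c * u t).re) 0) ^ 2 + ((c * u t).im) ^ 2 ≤ 1 / 3700 := by
  obtain ⟨c, hc, h⟩ := groundState_band83_almost_nonneg (δ' := 101 / 10000000000000000000) ha ha' (by norm_num)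
    (by norm_num) hu
  exact ⟨c, hc, h.trans (by norm_num)⟩

end Summit.RiemannHypothesis.RiemannHypothesis.Theorems.PolarPerronFrobenius

end
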